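import Summits.BirchSwinnertonDyer.BirchSwinnertonDyer.Theorems.PrintCf2DisegniPairTwoFrameCore
import Summits.BirchSwinnertonDyer.BirchSwinnertonDyer.Theorems.PrintCf2DisegniPairTwoFrameH0
import Summits.BirchSwinnertonDyer.BirchSwinnertonDyer.Theorems.PrintCf2DisegniPairTwoPeriodRatios
import Literature.NumberTheory.EllipticCurves.PadicSigmaSqMinusTwistBoundaryProofs
import HarnessLib

/-!
# Road (C) `disegni-pair-two` on crux stmt-BirchSwinnertonDyer-20368 — THE FRAME, class by class (`stub_frame_two`)

LEAD `bsd-line-cf2-p1` g21. The three conjuncts of the registered stub `stub_frame_two` of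
`Lines/disegni_pair_two.lean` (v3), VERBATIM, as theorems: `frame_chi8_two` (`d = 2d′`), `frame_chi4_two` (`d = −d′`),
`frame_chi8'_two` (`d = −2d′`). Each is `frame_core` at `d* = 2, −1, −2` plus the class-specific clauses: the
branch-point vanishing `h0` (Mazur–Tate–Teitelbaum interpolation at `χ₈` / `χ₋₄` / `χ₋₈` and `L(W,1) = 0` by Birch's
formula: tree `hasSum_coeff_padicLFunction_two_neg_two_zero`, `constantCoeff_padicLFunctionMinusBranch_one_two_of_coeffField`,
-w8's `algebraMap_tsum_coeff_padicLFunctionMinusBranch_neg_two` and Birch formulas), THE canonical minus-twist `2`-adic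
`ℚ`-datum (`cm7Twist_existsUnique_isCanonicalSqMinusTwist`) and the period ratio `ϖ` / `μ` of the partner's
parametrisation. THEOREMS ONLY; no `sorry`; no new definitions. BSD is not proved by any of this; 20368 is not closed here.
-/

set_option linter.dupNamespace false

noncomputable section

open scoped Classical MatrixGroups ModularForm NumberField NumberTheorySymbols

open CongruenceSubgroup NumberField IsDedekindDomain WeierstrassCurve WeierstrassCurve.Affine.Point
  Literature.NumberTheory.EllipticCurves Literature.NumberTheory.EllipticCurves.ModularForms
  Literature.NumberTheory.EllipticCurves.Disegni2017 Literature.NumberTheory.GaloisRepresentations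
  Summit.BirchSwinnertonDyer.Rank1Residual.AdditivePotMult Summit.BirchSwinnertonDyer.Rank1Residual.Additive

namespace Summit.BirchSwinnertonDyer.BirchSwinnertonDyer.Theorems.PrintCf2.DisegniPairTwo

/-! ### The three classes -/

set_option maxHeartbeats 800000 in
set_option linter.unusedVariables false in
/-- ★★★ **THE DISEGNI PAIR FRAME on the `χ₈∘N`-class (`d = 2d′`)** — conjunct 1 of the registered stub `stub_frame_two`, VERBATIM: `frame_core` at `d* = 2`, the branch-point vanishing `L₂(f_V,α_V)(−2) = 0`, THE canonical minus-twist `2`-adic `ℚ`-datum of `V^{(2)}` and the plus period ratio `ϖ`. [cite: FriedbergHoffstein1995, main theorem] [cite: MazurTateTeitelbaum1986Invent, §I.14] [cite: MazurSteinTate2006, §2.7] [cite: EdixhovenManin1991, §1] -/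
theorem frame_chi8_two (hmod : hasEntireLFunction_rat) (hnew : ModularForms.exists_isNewformOf)
    (hnp : ModularForms.nonempty_modularParametrizationData)
    (hFH : friedbergHoffstein_exists_heegnerField_split_twist_ne_zero)
    (hrank : rank_eq_analyticRank_of_analyticRank_le_one) :
    ∀ (d' d : ℤ), d' % 4 = 1 → Squarefree d' → d = 2 * d' →
      ∀ (W : WeierstrassCurve ℚ) [W.IsElliptic] [W.IsGloballyMinimal] (C₀ : VariableChange ℚ),
        C₀ • W = cm7.quadraticTwist (d : ℚ) → W.analyticRank = 1 →
      ∃ (K : Type) (_ : Field K) (_ : NumberField K) (_ : IsGalois ℚ K),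
        IsImaginaryQuadratic K ∧ Module.finrank ℚ K = 2 ∧
        ((Ideal.span {(2 : ℤ)}).primesOver (𝓞 K)).ncard = 2 ∧
      ∃ (𝔭 𝔭' : HeightOneSpectrum (𝓞 K)), ((2 : ℕ) : 𝓞 K) ∈ 𝔭.asIdeal ∧ ((2 : ℕ) : 𝓞 K) ∈ 𝔭'.asIdeal ∧ 𝔭 ≠ 𝔭' ∧
      ∃ (κ : DirichletCharacter ℂ (NumberField.discr K).natAbs),
        (∀ ℓ : ℕ, ℓ.Prime → ℓ ≠ 2 → κ ℓ = (jacobiSym (NumberField.discr K) ℓ : ℂ)) ∧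
        (κ 2 = if NumberField.discr K % 8 = 1 then 1 else if NumberField.discr K % 8 = 5 then -1 else 0) ∧
        Nat.Coprime 2 (NumberField.discr K).natAbs ∧
      ∃ (V V' : WeierstrassCurve ℚ) (_ : V.IsElliptic) (_ : V.IsGloballyMinimal) (_ : V'.IsElliptic)
        (_ : V'.IsGloballyMinimal) (C₁ : VariableChange ℚ),
        C₁ • V = cm7.quadraticTwist (d' : ℚ) ∧ IsOrdinaryAt V' 2 ∧ V'.frobeniusTrace 2 = V.frobeniusTrace 2 ∧
      ∃ (N N' : ℕ) (_ : NeZero N) (_ : NeZero N') (f : CuspForm (Gamma0 N) 2) (f' : CuspForm (Gamma0 N') 2),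
        IsNewformOf V f ∧ IsNewformOf V' f' ∧ (∀ n : ℕ, cuspCoeff f' n = κ (n : ZMod _) * cuspCoeff f n) ∧
        HasSum (fun k : ℕ ↦ PowerSeries.coeff k (padicLFunction f (unitRoot V 2 : ℚ_[2])) * (-2 : ℚ_[2]) ^ k) 0 ∧
      ∃ (M M' : ℕ) (_ : NeZero M) (_ : NeZero M') (g : CuspForm (Gamma0 M) 2) (g' : CuspForm (Gamma0 M') 2)
        (W' : WeierstrassCurve ℚ) (_ : W'.IsElliptic),
        IsNewformOf W g ∧ IsNewformOf W' g' ∧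
        (∀ m : ℕ, cuspCoeff g m = (ZMod.χ₈.ringHomComp (Int.castRingHom ℂ)) m * cuspCoeff f m) ∧
        (∀ m : ℕ, cuspCoeff g' m = (ZMod.χ₈.ringHomComp (Int.castRingHom ℂ)) m * cuspCoeff f' m) ∧
        W'.entireLFunction 1 ≠ 0 ∧
      ∃ (H : Type) (_ : Field H) (_ : NumberField H) (_ : Algebra K H) (hKH : Module.finrank K H = 2) (t : H)
        (htK : t ∉ Set.range (algebraMap K H)) (ht2 : t ^ 2 = algebraMap ℚ H 2)
        (G : Subgroup (H ≃ₐ[ℚ] H)) (χ : G →* ℂˣ) (s : G → ℤ) (_ : ∀ σ, ((χ σ : ℂˣ) : ℂ) = (s σ : ℂ))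
        (τ : H ≃ₐ[ℚ] H) (hτG : τ ∈ G), s ⟨τ, hτG⟩ = -1 ∧ (∀ a : K, τ (algebraMap K H a) = algebraMap K H a) ∧
        τ t = -t ∧
      ∃ (u : K) (e : ℚ), u ∉ Set.range (algebraMap ℚ K) ∧ u ^ 2 = algebraMap ℚ K e ∧
      ∃ (c : K ≃ₐ[ℚ] K), c u = -u ∧
      ∃ (_ : (V.quadraticTwist 2).IsElliptic) (C : VariableChange ℚ), C • W = V.quadraticTwist 2 ∧
      ∃ (P : (V.quadraticTwist 2).toAffine.Point), ¬ IsOfFinAddOrder P ∧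
        (∀ R : (V.quadraticTwist 2).toAffine.Point,
          ∃ (k : ℤ) (T : (V.quadraticTwist 2).toAffine.Point), IsOfFinAddOrder T ∧ R = k • P + T) ∧
        (∀ Q : ((V.quadraticTwist 2).quadraticTwist e).toAffine.Point, IsOfFinAddOrder Q) ∧
      ∃ (Dc : PAdicHeightData (V.quadraticTwist 2) 2), Dc.IsCanonicalSqMinusTwist ∧
      ∃ (ϖ : ℚ), ϖ ≠ 0 ∧ (ϖ : ℝ) * V.realPeriodRat = plusPeriod f := by
  intro d' d hd4 hsq hd W _ _ C₀ hC₀ hr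
  haveI : Fact (2 : ℕ).Prime := ⟨Nat.prime_two⟩
  have hd' : d = 2 * d' := hd
  have hcore := frame_core hmod hnew hnp hFH hrank (ds := 2) (Or.inl rfl) hd4 hsq hd' W C₀ hC₀ hr
  obtain ⟨K, hKf, hKn, hKg, hK, h2K, hsplit, 𝔭, 𝔭', h𝔭, h𝔭', hne, κ, hκ, hκ2, hcop, k, V, V', hVell, hVmin, hV'ell, hV'min,
    C₁, hV, hk, hC₁, hordV, hordV', hap, N, N', hN, hN', f, f', hf, hf', hV'coef, ⟨DV⟩, M, M', hM, hM', g, g', W', hW'ell,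
    hg, hg', hgε, hg'ε, hL', hL0, H, hHf, hHn, hHa, hKH, t, htK, ht2, G, χ, s, hs, τ, hτG, hsτ, hτK, hτt, u, e, hu, hue,
    c, hcu, hVds, C, hC, P, hP, hgen, htors⟩ := hcore
  have hgε' : ∀ m : ℕ, cuspCoeff g m = (ZMod.χ₈.ringHomComp (Int.castRingHom ℂ)) m * cuspCoeff f m := fun m => by
    rw [hgε m, chi8_ringHomComp_natCast]
  have hg'ε' : ∀ m : ℕ, cuspCoeff g' m = (ZMod.χ₈.ringHomComp (Int.castRingHom ℂ)) m * cuspCoeff f' m := fun m => by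
    rw [hg'ε m, chi8_ringHomComp_natCast]
  have ht2' : t ^ 2 = algebraMap ℚ H 2 := by exact_mod_cast ht2
  have h0 := hasSum_padicLFunction_neg_two_zero_of_member V W hordV hf hC hr
  obtain ⟨Dc, hDc, -⟩ := cm7Twist_existsUnique_isCanonicalSqMinusTwist V k hV (d := 2) (Or.inr (Or.inl rfl))
  obtain ⟨ϖ, hϖ0, hϖ⟩ := exists_plusPeriodRatio_of_parametrization DV hf
  refine ⟨K, hKf, hKn, hKg, hK, h2K, hsplit, 𝔭, 𝔭', h𝔭, h𝔭', hne, κ, hκ, hκ2, hcop, ?_⟩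
  refine ⟨V, V', hVell, hVmin, hV'ell, hV'min, C₁, hC₁, hordV', hap, ?_⟩
  refine ⟨N, N', hN, hN', f, f', hf, hf', hV'coef, h0, ?_⟩
  refine ⟨M, M', hM, hM', g, g', W', hW'ell, hg, hg', hgε', hg'ε', hL', ?_⟩
  refine ⟨H, hHf, hHn, hHa, hKH, t, htK, ht2', G, χ, s, hs, τ, hτG, hsτ, hτK, hτt, ?_⟩
  exact ⟨u, e, hu, hue, c, hcu, hVds, C, hC, P, hP, hgen, htors, Dc, hDc, ϖ, hϖ0, hϖ⟩

set_option maxHeartbeats 800000 in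
set_option linter.unusedVariables false in
/-- ★★★ **THE DISEGNI PAIR FRAME on the `χ₋₄∘N`-class (`d = −d′`)** — conjunct 2 of `stub_frame_two`, VERBATIM: `frame_core` at `d* = −1`, the vanishing of the constant term of the odd branch, THE canonical minus-twist datum of `V^{(−1)}` and the minus period ratio `μ`. [cite: FriedbergHoffstein1995, main theorem] [cite: MazurTateTeitelbaum1986Invent, §I.13] [cite: MazurSteinTate2006, §2.7] [cite: EdixhovenManin1991, §1] -/
theorem frame_chi4_two (hmod : hasEntireLFunction_rat) (hnew : ModularForms.exists_isNewformOf)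
    (hnp : ModularForms.nonempty_modularParametrizationData)
    (hFH : friedbergHoffstein_exists_heegnerField_split_twist_ne_zero)
    (hrank : rank_eq_analyticRank_of_analyticRank_le_one) :
    ∀ (d' d : ℤ), d' % 4 = 1 → Squarefree d' → d = -d' →
      ∀ (W : WeierstrassCurve ℚ) [W.IsElliptic] [W.IsGloballyMinimal] (C₀ : VariableChange ℚ),
        C₀ • W = cm7.quadraticTwist (d : ℚ) → W.analyticRank = 1 →
      ∃ (K : Type) (_ : Field K) (_ : NumberField K) (_ : IsGalois ℚ K),
        IsImaginaryQuadratic K ∧ Module.finrank ℚ K = 2 ∧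
        ((Ideal.span {(2 : ℤ)}).primesOver (𝓞 K)).ncard = 2 ∧
      ∃ (𝔭 𝔭' : HeightOneSpectrum (𝓞 K)), ((2 : ℕ) : 𝓞 K) ∈ 𝔭.asIdeal ∧ ((2 : ℕ) : 𝓞 K) ∈ 𝔭'.asIdeal ∧ 𝔭 ≠ 𝔭' ∧
      ∃ (κ : DirichletCharacter ℂ (NumberField.discr K).natAbs),
        (∀ ℓ : ℕ, ℓ.Prime → ℓ ≠ 2 → κ ℓ = (jacobiSym (NumberField.discr K) ℓ : ℂ)) ∧
        (κ 2 = if NumberField.discr K % 8 = 1 then 1 else if NumberField.discr K % 8 = 5 then -1 else 0) ∧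
        Nat.Coprime 2 (NumberField.discr K).natAbs ∧
      ∃ (V V' : WeierstrassCurve ℚ) (_ : V.IsElliptic) (_ : V.IsGloballyMinimal) (_ : V'.IsElliptic)
        (_ : V'.IsGloballyMinimal) (C₁ : VariableChange ℚ),
        C₁ • V = cm7.quadraticTwist (d' : ℚ) ∧ IsOrdinaryAt V' 2 ∧ V'.frobeniusTrace 2 = V.frobeniusTrace 2 ∧
      ∃ (N N' : ℕ) (_ : NeZero N) (_ : NeZero N') (f : CuspForm (Gamma0 N) 2) (f' : CuspForm (Gamma0 N') 2),
        IsNewformOf V f ∧ IsNewformOf V' f' ∧ (∀ n : ℕ, cuspCoeff f' n = κ (n : ZMod _) * cuspCoeff f n) ∧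
        PowerSeries.constantCoeff (padicLFunctionMinusBranch f (unitRoot V 2 : ℚ_[2]) 1) = 0 ∧
      ∃ (M M' : ℕ) (_ : NeZero M) (_ : NeZero M') (g : CuspForm (Gamma0 M) 2) (g' : CuspForm (Gamma0 M') 2)
        (W' : WeierstrassCurve ℚ) (_ : W'.IsElliptic),
        IsNewformOf W g ∧ IsNewformOf W' g' ∧
        (∀ m : ℕ, cuspCoeff g m = (ZMod.χ₄.ringHomComp (Int.castRingHom ℂ)) m * cuspCoeff f m) ∧
        (∀ m : ℕ, cuspCoeff g' m = (ZMod.χ₄.ringHomComp (Int.castRingHom ℂ)) m * cuspCoeff f' m) ∧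
        W'.entireLFunction 1 ≠ 0 ∧
      ∃ (H : Type) (_ : Field H) (_ : NumberField H) (_ : Algebra K H) (hKH : Module.finrank K H = 2) (t : H)
        (htK : t ∉ Set.range (algebraMap K H)) (ht2 : t ^ 2 = algebraMap ℚ H (-1))
        (G : Subgroup (H ≃ₐ[ℚ] H)) (χ : G →* ℂˣ) (s : G → ℤ) (_ : ∀ σ, ((χ σ : ℂˣ) : ℂ) = (s σ : ℂ))
        (τ : H ≃ₐ[ℚ] H) (hτG : τ ∈ G), s ⟨τ, hτG⟩ = -1 ∧ (∀ a : K, τ (algebraMap K H a) = algebraMap K H a) ∧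
        τ t = -t ∧
      ∃ (u : K) (e : ℚ), u ∉ Set.range (algebraMap ℚ K) ∧ u ^ 2 = algebraMap ℚ K e ∧
      ∃ (c : K ≃ₐ[ℚ] K), c u = -u ∧
      ∃ (_ : (V.quadraticTwist (-1)).IsElliptic) (C : VariableChange ℚ), C • W = V.quadraticTwist (-1) ∧
      ∃ (P : (V.quadraticTwist (-1)).toAffine.Point), ¬ IsOfFinAddOrder P ∧
        (∀ R : (V.quadraticTwist (-1)).toAffine.Point,
          ∃ (k : ℤ) (T : (V.quadraticTwist (-1)).toAffine.Point), IsOfFinAddOrder T ∧ R = k • P + T) ∧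
        (∀ Q : ((V.quadraticTwist (-1)).quadraticTwist e).toAffine.Point, IsOfFinAddOrder Q) ∧
      ∃ (Dc : PAdicHeightData (V.quadraticTwist (-1)) 2), Dc.IsCanonicalSqMinusTwist ∧
      ∃ (μ : ℚ), μ ≠ 0 ∧ (μ : ℝ) * V.imaginaryPeriodRat = minusPeriod f := by
  intro d' d hd4 hsq hd W _ _ C₀ hC₀ hr
  haveI : Fact (2 : ℕ).Prime := ⟨Nat.prime_two⟩
  have hd' : d = -1 * d' := by rw [hd]; ring
  have hcore := frame_core hmod hnew hnp hFH hrank (ds := -1) (Or.inr (Or.inl rfl)) hd4 hsq hd' W C₀ hC₀ hr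
  obtain ⟨K, hKf, hKn, hKg, hK, h2K, hsplit, 𝔭, 𝔭', h𝔭, h𝔭', hne, κ, hκ, hκ2, hcop, k, V, V', hVell, hVmin, hV'ell, hV'min,
    C₁, hV, hk, hC₁, hordV, hordV', hap, N, N', hN, hN', f, f', hf, hf', hV'coef, ⟨DV⟩, M, M', hM, hM', g, g', W', hW'ell,
    hg, hg', hgε, hg'ε, hL', hL0, H, hHf, hHn, hHa, hKH, t, htK, ht2, G, χ, s, hs, τ, hτG, hsτ, hτK, hτt, u, e, hu, hue,
    c, hcu, hVds, C, hC, P, hP, hgen, htors⟩ := hcore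
  have hgε' : ∀ m : ℕ, cuspCoeff g m = (ZMod.χ₄.ringHomComp (Int.castRingHom ℂ)) m * cuspCoeff f m := fun m => by
    rw [hgε m, chi4_ringHomComp_natCast]
  have hg'ε' : ∀ m : ℕ, cuspCoeff g' m = (ZMod.χ₄.ringHomComp (Int.castRingHom ℂ)) m * cuspCoeff f' m := fun m => by
    rw [hg'ε m, chi4_ringHomComp_natCast]
  have ht2' : t ^ 2 = algebraMap ℚ H (-1) := by exact_mod_cast ht2
  have h0 := constantCoeff_padicLFunctionMinusBranch_zero_of_member hmod V W hordV hf hg hgε' hL0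
  obtain ⟨Dc, hDc, -⟩ := cm7Twist_existsUnique_isCanonicalSqMinusTwist V k hV (d := -1) (Or.inl rfl)
  obtain ⟨μ, hμ0, hμ⟩ := exists_minusPeriodRatio_of_parametrization DV hf
  refine ⟨K, hKf, hKn, hKg, hK, h2K, hsplit, 𝔭, 𝔭', h𝔭, h𝔭', hne, κ, hκ, hκ2, hcop, ?_⟩
  refine ⟨V, V', hVell, hVmin, hV'ell, hV'min, C₁, hC₁, hordV', hap, ?_⟩
  refine ⟨N, N', hN, hN', f, f', hf, hf', hV'coef, h0, ?_⟩
  refine ⟨M, M', hM, hM', g, g', W', hW'ell, hg, hg', hgε', hg'ε', hL', ?_⟩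
  refine ⟨H, hHf, hHn, hHa, hKH, t, htK, ht2', G, χ, s, hs, τ, hτG, hsτ, hτK, hτt, ?_⟩
  exact ⟨u, e, hu, hue, c, hcu, hVds, C, hC, P, hP, hgen, htors, Dc, hDc, μ, hμ0, hμ⟩

set_option maxHeartbeats 800000 in
set_option linter.unusedVariables false in
/-- ★★★ **THE DISEGNI PAIR FRAME on the `χ₋₈∘N`-class (`d = −2d′`)** — conjunct 3 of `stub_frame_two`, VERBATIM: `frame_core` at `d* = −2`, the vanishing of the odd branch at `T = −2`, THE canonical minus-twist datum of `V^{(−2)}` and the minus period ratio `μ`. [cite: FriedbergHoffstein1995, main theorem] [cite: MazurTateTeitelbaum1986Invent, §I.13–I.14] [cite: MazurSteinTate2006, §2.7] [cite: EdixhovenManin1991, §1] -/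
theorem frame_chi8'_two (hmod : hasEntireLFunction_rat) (hnew : ModularForms.exists_isNewformOf)
    (hnp : ModularForms.nonempty_modularParametrizationData)
    (hFH : friedbergHoffstein_exists_heegnerField_split_twist_ne_zero)
    (hrank : rank_eq_analyticRank_of_analyticRank_le_one) :
    ∀ (d' d : ℤ), d' % 4 = 1 → Squarefree d' → d = -2 * d' →
      ∀ (W : WeierstrassCurve ℚ) [W.IsElliptic] [W.IsGloballyMinimal] (C₀ : VariableChange ℚ),
        C₀ • W = cm7.quadraticTwist (d : ℚ) → W.analyticRank = 1 →
      ∃ (K : Type) (_ : Field K) (_ : NumberField K) (_ : IsGalois ℚ K),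
        IsImaginaryQuadratic K ∧ Module.finrank ℚ K = 2 ∧
        ((Ideal.span {(2 : ℤ)}).primesOver (𝓞 K)).ncard = 2 ∧
      ∃ (𝔭 𝔭' : HeightOneSpectrum (𝓞 K)), ((2 : ℕ) : 𝓞 K) ∈ 𝔭.asIdeal ∧ ((2 : ℕ) : 𝓞 K) ∈ 𝔭'.asIdeal ∧ 𝔭 ≠ 𝔭' ∧
      ∃ (κ : DirichletCharacter ℂ (NumberField.discr K).natAbs),
        (∀ ℓ : ℕ, ℓ.Prime → ℓ ≠ 2 → κ ℓ = (jacobiSym (NumberField.discr K) ℓ : ℂ)) ∧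
        (κ 2 = if NumberField.discr K % 8 = 1 then 1 else if NumberField.discr K % 8 = 5 then -1 else 0) ∧
        Nat.Coprime 2 (NumberField.discr K).natAbs ∧
      ∃ (V V' : WeierstrassCurve ℚ) (_ : V.IsElliptic) (_ : V.IsGloballyMinimal) (_ : V'.IsElliptic)
        (_ : V'.IsGloballyMinimal) (C₁ : VariableChange ℚ),
        C₁ • V = cm7.quadraticTwist (d' : ℚ) ∧ IsOrdinaryAt V' 2 ∧ V'.frobeniusTrace 2 = V.frobeniusTrace 2 ∧
      ∃ (N N' : ℕ) (_ : NeZero N) (_ : NeZero N') (f : CuspForm (Gamma0 N) 2) (f' : CuspForm (Gamma0 N') 2),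
        IsNewformOf V f ∧ IsNewformOf V' f' ∧ (∀ n : ℕ, cuspCoeff f' n = κ (n : ZMod _) * cuspCoeff f n) ∧
        HasSum (fun k : ℕ ↦ PowerSeries.coeff k (padicLFunctionMinusBranch f (unitRoot V 2 : ℚ_[2]) 1) *
          (-2 : ℚ_[2]) ^ k) 0 ∧
      ∃ (M M' : ℕ) (_ : NeZero M) (_ : NeZero M') (g : CuspForm (Gamma0 M) 2) (g' : CuspForm (Gamma0 M') 2)
        (W' : WeierstrassCurve ℚ) (_ : W'.IsElliptic),
        IsNewformOf W g ∧ IsNewformOf W' g' ∧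
        (∀ m : ℕ, cuspCoeff g m = (ZMod.χ₈'.ringHomComp (Int.castRingHom ℂ)) m * cuspCoeff f m) ∧
        (∀ m : ℕ, cuspCoeff g' m = (ZMod.χ₈'.ringHomComp (Int.castRingHom ℂ)) m * cuspCoeff f' m) ∧
        W'.entireLFunction 1 ≠ 0 ∧
      ∃ (H : Type) (_ : Field H) (_ : NumberField H) (_ : Algebra K H) (hKH : Module.finrank K H = 2) (t : H)
        (htK : t ∉ Set.range (algebraMap K H)) (ht2 : t ^ 2 = algebraMap ℚ H (-2))
        (G : Subgroup (H ≃ₐ[ℚ] H)) (χ : G →* ℂˣ) (s : G → ℤ) (_ : ∀ σ, ((χ σ : ℂˣ) : ℂ) = (s σ : ℂ))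
        (τ : H ≃ₐ[ℚ] H) (hτG : τ ∈ G), s ⟨τ, hτG⟩ = -1 ∧ (∀ a : K, τ (algebraMap K H a) = algebraMap K H a) ∧
        τ t = -t ∧
      ∃ (u : K) (e : ℚ), u ∉ Set.range (algebraMap ℚ K) ∧ u ^ 2 = algebraMap ℚ K e ∧
      ∃ (c : K ≃ₐ[ℚ] K), c u = -u ∧
      ∃ (_ : (V.quadraticTwist (-2)).IsElliptic) (C : VariableChange ℚ), C • W = V.quadraticTwist (-2) ∧
      ∃ (P : (V.quadraticTwist (-2)).toAffine.Point), ¬ IsOfFinAddOrder P ∧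
        (∀ R : (V.quadraticTwist (-2)).toAffine.Point,
          ∃ (k : ℤ) (T : (V.quadraticTwist (-2)).toAffine.Point), IsOfFinAddOrder T ∧ R = k • P + T) ∧
        (∀ Q : ((V.quadraticTwist (-2)).quadraticTwist e).toAffine.Point, IsOfFinAddOrder Q) ∧
      ∃ (Dc : PAdicHeightData (V.quadraticTwist (-2)) 2), Dc.IsCanonicalSqMinusTwist ∧
      ∃ (μ : ℚ), μ ≠ 0 ∧ (μ : ℝ) * V.imaginaryPeriodRat = minusPeriod f := by
  intro d' d hd4 hsq hd W _ _ C₀ hC₀ hr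
  haveI : Fact (2 : ℕ).Prime := ⟨Nat.prime_two⟩
  have hd' : d = -2 * d' := hd
  have hcore := frame_core hmod hnew hnp hFH hrank (ds := -2) (Or.inr (Or.inr rfl)) hd4 hsq hd' W C₀ hC₀ hr
  obtain ⟨K, hKf, hKn, hKg, hK, h2K, hsplit, 𝔭, 𝔭', h𝔭, h𝔭', hne, κ, hκ, hκ2, hcop, k, V, V', hVell, hVmin, hV'ell, hV'min,
    C₁, hV, hk, hC₁, hordV, hordV', hap, N, N', hN, hN', f, f', hf, hf', hV'coef, ⟨DV⟩, M, M', hM, hM', g, g', W', hW'ell,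
    hg, hg', hgε, hg'ε, hL', hL0, H, hHf, hHn, hHa, hKH, t, htK, ht2, G, χ, s, hs, τ, hτG, hsτ, hτK, hτt, u, e, hu, hue,
    c, hcu, hVds, C, hC, P, hP, hgen, htors⟩ := hcore
  have hgε' : ∀ m : ℕ, cuspCoeff g m = (ZMod.χ₈'.ringHomComp (Int.castRingHom ℂ)) m * cuspCoeff f m := fun m => by
    rw [hgε m, chi8'_ringHomComp_natCast]
  have hg'ε' : ∀ m : ℕ, cuspCoeff g' m = (ZMod.χ₈'.ringHomComp (Int.castRingHom ℂ)) m * cuspCoeff f' m := fun m => by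
    rw [hg'ε m, chi8'_ringHomComp_natCast]
  have ht2' : t ^ 2 = algebraMap ℚ H (-2) := by exact_mod_cast ht2
  have h0 := hasSum_padicLFunctionMinusBranch_neg_two_zero_of_member hmod V W hordV hf hg hgε' hL0
  obtain ⟨Dc, hDc, -⟩ := cm7Twist_existsUnique_isCanonicalSqMinusTwist V k hV (d := -2) (Or.inr (Or.inr rfl))
  obtain ⟨μ, hμ0, hμ⟩ := exists_minusPeriodRatio_of_parametrization DV hf
  refine ⟨K, hKf, hKn, hKg, hK, h2K, hsplit, 𝔭, 𝔭', h𝔭, h𝔭', hne, κ, hκ, hκ2, hcop, ?_⟩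
  refine ⟨V, V', hVell, hVmin, hV'ell, hV'min, C₁, hC₁, hordV', hap, ?_⟩
  refine ⟨N, N', hN, hN', f, f', hf, hf', hV'coef, h0, ?_⟩
  refine ⟨M, M', hM, hM', g, g', W', hW'ell, hg, hg', hgε', hg'ε', hL', ?_⟩
  refine ⟨H, hHf, hHn, hHa, hKH, t, htK, ht2', G, χ, s, hs, τ, hτG, hsτ, hτK, hτt, ?_⟩
  exact ⟨u, e, hu, hue, c, hcu, hVds, C, hC, P, hP, hgen, htors, Dc, hDc, μ, hμ0, hμ⟩

end Summit.BirchSwinnertonDyer.BirchSwinnertonDyer.Theorems.PrintCf2.DisegniPairTwo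

end
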